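import Mathlib
import HarnessLib
import Summits.ValiantsHypothesis.ValiantsHypothesis.Theorems.LacunarySymmetroidMatrixDescartesProductPlusOneSlopePhases

/-!
# LINE (A) `product_plus_one` — ANY NUMBER of knees of the middle rate `q − p` against thinner-or-equal poles BEHIND the window: at most ONE zero of
# `W(∏ fewnomial)` — fast knees do not separate without a slower or forward background (the tilt `x^{q−p}·Σψ₁` is strictly monotone)

Crux item stmt-ValiantsHypothesis-18050, W-budget frame EB2-W; tropical W-CB (owner memo §20.2, eng-11 R2: «a faster bump is a separate component iff it sits
on a negative background of SLOWER rate»).  Notation of ✓ `…CloudDefs` (`β = Bx^p`, `γ = Cx^q`, `u = rowU`, `ψ_k = rowPsi_k`, `R := q − p = e₂ + 1`).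
§1 TILT IDENTITIES (binomial rows, off their zero; `βu + γu + 1 = A·u`): `pair12_rowPsi2_add_eq` (`A = 0`: `ψ₂ + Rψ₁ = 2R³(βu)²(γu)`),
`pair02_rowPsi2_add_eq` (`B = 0`: `ψ₂ + Rψ₁ = q²(Au)(γu)(q(Au+γu) + R)`), `pair01_rowPsi2_add_eq` (`C = 0`: `p²(Au)(βu)(p(Au+βu) + R)`); signs
`pair12_rowPsi2_add_neg` (knee, or pole seen from the right: `γ(β+γ) > 0`), `pair02_rowPsi2_add_neg` (switched pole, `A·F < 0`), `pair01_rowPsi2_add_neg`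
(switched pole, `e₂ ≤ e₁`) — all `ψ₂ + Rψ₁ < 0`, i.e. the tilted field `x^R·(−ψ₁)` of each such row is strictly increasing (`hasDerivAt_pow_mul_rowPsi1`).
§2 ★★ `outerKnees_wronskian_roots_le_one` (LINE currency, support `d 1 = d 0 + e₁ + 1`, `d 2 = d 1 + e₂ + 1`, `0 < u`): every row is a one-signed binomial on
the pair (1,2) (`a₀ = 0 < a₁a₂`, a rate-R knee ANYWHERE, any number) or a one-change binomial on (1,2) / (0,2) switched at `u` (`0 < a₂·f(u)`; poles of
rates R, q behind the window) or, when `e₂ ≤ e₁`, on (0,1) switched at `u` (`0 < a₁·f(u)`) ⇒ `#{roots of W(∏ f) in (u,v)} ≤ 1`;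
`outerKnees_eulerNumerator_roots_le_two` (≤ 2 on `[u,v]`, every coupling).  The «+1 per fast knee» needs a SLOWER pole or a pole AHEAD.
HONEST FRAMING: a binomial cell; nothing here proves `WronskianBudgetK3` / `OneChangeFloorK3` / the stubs / 18050 / `MatrixDescartes`; `VP ≠ VNP` is NOT
proved.  No definitions, no named facts.
-/

set_option linter.dupNamespace false

namespace Summit.ValiantsHypothesis.ValiantsHypothesis.Theorems.LacunarySymmetroidMatrixDescartes

namespace ProductPlusOne

open Finset Polynomial
open scoped BigOperators Polynomial

/-! ### §1 The tilt identities and their signs -/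

section Row

variable (e₁ e₂ : ℕ) (A B C : ℝ)

/-- **Pair (1,2)** (`A = 0`): `ψ₂ + (e₂+1)·ψ₁ = 2(e₂+1)³·(βu)²·(γu)`. [this file's lemma] -/
theorem pair12_rowPsi2_add_eq {x : ℝ} (hF : (0 : ℝ) - B * x ^ (e₁ + 1) - C * x ^ (e₁ + e₂ + 2) ≠ 0) :
    rowPsi2 e₁ e₂ 0 B C x + ((e₂ : ℝ) + 1) * rowPsi1 e₁ e₂ 0 B C x
      = 2 * ((e₂ : ℝ) + 1) ^ 3 * ((B * x ^ (e₁ + 1)) * rowU e₁ e₂ 0 B C x) ^ 2 * ((C * x ^ (e₁ + e₂ + 2)) * rowU e₁ e₂ 0 B C x) := by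
  unfold rowPsi2 rowPsi1 rowH rowU
  field_simp
  ring

/-- **Pair (0,2)** (`B = 0`): `ψ₂ + (e₂+1)·ψ₁ = q²·(Au)(γu)·(q(Au + γu) + (e₂+1))`. [this file's lemma] -/
theorem pair02_rowPsi2_add_eq {x : ℝ} (hF : A - 0 * x ^ (e₁ + 1) - C * x ^ (e₁ + e₂ + 2) ≠ 0) :
    rowPsi2 e₁ e₂ A 0 C x + ((e₂ : ℝ) + 1) * rowPsi1 e₁ e₂ A 0 C x
      = ((e₁ : ℝ) + e₂ + 2) ^ 2 * (A * rowU e₁ e₂ A 0 C x) * ((C * x ^ (e₁ + e₂ + 2)) * rowU e₁ e₂ A 0 C x)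
        * (((e₁ : ℝ) + e₂ + 2) * (A * rowU e₁ e₂ A 0 C x + (C * x ^ (e₁ + e₂ + 2)) * rowU e₁ e₂ A 0 C x) + ((e₂ : ℝ) + 1)) := by
  have hF' : A - C * x ^ (e₁ + e₂ + 2) ≠ 0 := by simpa using hF
  unfold rowPsi2 rowPsi1 rowH rowU
  simp only [mul_zero, zero_mul, zero_add, sub_zero]
  field_simp
  ring

/-- **Pair (0,1)** (`C = 0`): `ψ₂ + (e₂+1)·ψ₁ = p²·(Au)(βu)·(p(Au + βu) + (e₂+1))`. [this file's lemma] -/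
theorem pair01_rowPsi2_add_eq {x : ℝ} (hF : A - B * x ^ (e₁ + 1) - 0 * x ^ (e₁ + e₂ + 2) ≠ 0) :
    rowPsi2 e₁ e₂ A B 0 x + ((e₂ : ℝ) + 1) * rowPsi1 e₁ e₂ A B 0 x
      = ((e₁ : ℝ) + 1) ^ 2 * (A * rowU e₁ e₂ A B 0 x) * ((B * x ^ (e₁ + 1)) * rowU e₁ e₂ A B 0 x)
        * (((e₁ : ℝ) + 1) * (A * rowU e₁ e₂ A B 0 x + (B * x ^ (e₁ + 1)) * rowU e₁ e₂ A B 0 x) + ((e₂ : ℝ) + 1)) := by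
  have hF' : A - B * x ^ (e₁ + 1) ≠ 0 := by simpa using hF
  unfold rowPsi2 rowPsi1 rowH rowU
  simp only [mul_zero, zero_mul, add_zero, sub_zero]
  field_simp
  ring

/-- ★ **Pair (1,2), seen from the right of the root (or a one-signed knee anywhere):** `B ≠ 0` and `γ·(β + γ) > 0` ⇒ `ψ₂ + (e₂+1)ψ₁ < 0`. [this file's theorem] -/
theorem pair12_rowPsi2_add_neg {x : ℝ} (hx : 0 < x) (hB : B ≠ 0)
    (hγE : 0 < (C * x ^ (e₁ + e₂ + 2)) * (B * x ^ (e₁ + 1) + C * x ^ (e₁ + e₂ + 2))) :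
    rowPsi2 e₁ e₂ 0 B C x + ((e₂ : ℝ) + 1) * rowPsi1 e₁ e₂ 0 B C x < 0 := by
  set β := B * x ^ (e₁ + 1) with hβ
  set γ := C * x ^ (e₁ + e₂ + 2) with hγ
  have hE : β + γ ≠ 0 := by intro h; rw [h, mul_zero] at hγE; exact lt_irrefl 0 hγE
  have hF : (0 : ℝ) - B * x ^ (e₁ + 1) - C * x ^ (e₁ + e₂ + 2) ≠ 0 := by
    rw [← hβ, ← hγ]; intro h; apply hE; linarith
  rw [pair12_rowPsi2_add_eq e₁ e₂ B C hF]
  have hu : rowU e₁ e₂ 0 B C x = -(β + γ)⁻¹ := by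
    unfold rowU; rw [← hβ, ← hγ]
    rw [show (0 : ℝ) - β - γ = -(β + γ) by ring, inv_neg]
  have hγu : γ * rowU e₁ e₂ 0 B C x < 0 := by
    rw [hu]
    have hE2 : 0 < (β + γ) ^ 2 := by positivity
    have : γ * -(β + γ)⁻¹ = -(γ * (β + γ)) / (β + γ) ^ 2 := by field_simp
    rw [this]
    exact div_neg_of_neg_of_pos (by linarith) hE2
  have hβu : 0 < (β * rowU e₁ e₂ 0 B C x) ^ 2 := by
    have hβ0 : β ≠ 0 := by rw [hβ]; exact mul_ne_zero hB (pow_ne_zero _ hx.ne')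
    have hu0 : rowU e₁ e₂ 0 B C x ≠ 0 := by rw [hu]; exact neg_ne_zero.2 (inv_ne_zero hE)
    positivity
  have h1 : 0 < 2 * ((e₂ : ℝ) + 1) ^ 3 * (β * rowU e₁ e₂ 0 B C x) ^ 2 := by positivity
  exact mul_neg_of_pos_of_neg h1 hγu

/-- ★ **Pair (0,2), switched pole** (`B = 0`, `A·(A − Cx^q) < 0`): `ψ₂ + (e₂+1)ψ₁ < 0` (its rate `q` is at least `R = q − p`). [this file's theorem] -/
theorem pair02_rowPsi2_add_neg {x : ℝ} (hAF : A * (A - C * x ^ (e₁ + e₂ + 2)) < 0) :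
    rowPsi2 e₁ e₂ A 0 C x + ((e₂ : ℝ) + 1) * rowPsi1 e₁ e₂ A 0 C x < 0 := by
  have hF' : A - C * x ^ (e₁ + e₂ + 2) ≠ 0 := by intro h; rw [h, mul_zero] at hAF; exact lt_irrefl 0 hAF
  have hF : A - 0 * x ^ (e₁ + 1) - C * x ^ (e₁ + e₂ + 2) ≠ 0 := by simpa using hF'
  rw [pair02_rowPsi2_add_eq e₁ e₂ A C hF]
  set u := rowU e₁ e₂ A 0 C x with hudef
  have hu : u = (A - C * x ^ (e₁ + e₂ + 2))⁻¹ := by rw [hudef]; unfold rowU; simp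
  set P := A * u with hP
  set G := (C * x ^ (e₁ + e₂ + 2)) * u with hG
  -- `P − G = 1`, `P < 0`
  have hPG : P - G = 1 := by
    rw [hP, hG, hu]; field_simp
  have hPneg : P < 0 := by
    rw [hP, hu]
    have h2 : 0 < (A - C * x ^ (e₁ + e₂ + 2)) ^ 2 := by positivity
    have : A * (A - C * x ^ (e₁ + e₂ + 2))⁻¹ = A * (A - C * x ^ (e₁ + e₂ + 2)) / (A - C * x ^ (e₁ + e₂ + 2)) ^ 2 := by
      field_simp
    rw [this]; exact div_neg_of_neg_of_pos hAF h2
  have hGneg : G < 0 := by linarith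
  have hPG' : 0 < P * G := mul_pos_of_neg_of_neg hPneg hGneg
  have hq : ((e₂ : ℝ) + 1) ≤ ((e₁ : ℝ) + e₂ + 2) := by linarith [show (0 : ℝ) ≤ (e₁ : ℝ) + 1 by positivity]
  have hlin : ((e₁ : ℝ) + e₂ + 2) * (P + G) + ((e₂ : ℝ) + 1) < 0 := by
    have hsum : P + G < -1 := by linarith
    have hq0 : 0 < ((e₁ : ℝ) + e₂ + 2) := by positivity
    nlinarith
  have hq2 : 0 < ((e₁ : ℝ) + e₂ + 2) ^ 2 := by positivity
  have : ((e₁ : ℝ) + e₂ + 2) ^ 2 * P * G * (((e₁ : ℝ) + e₂ + 2) * (P + G) + ((e₂ : ℝ) + 1)) < 0 := by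
    have h1 : 0 < ((e₁ : ℝ) + e₂ + 2) ^ 2 * P * G := by rw [mul_assoc]; exact mul_pos hq2 hPG'
    exact mul_neg_of_pos_of_neg h1 hlin
  linarith

/-- ★ **Pair (0,1), switched pole, when `e₂ ≤ e₁`** (`C = 0`, `A·(A − Bx^p) < 0`): `ψ₂ + (e₂+1)ψ₁ < 0` (its rate `p = e₁+1 ≥ R = e₂+1`). [this file's theorem] -/
theorem pair01_rowPsi2_add_neg (he : e₂ ≤ e₁) {x : ℝ} (hAF : A * (A - B * x ^ (e₁ + 1)) < 0) :
    rowPsi2 e₁ e₂ A B 0 x + ((e₂ : ℝ) + 1) * rowPsi1 e₁ e₂ A B 0 x < 0 := by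
  have hF' : A - B * x ^ (e₁ + 1) ≠ 0 := by intro h; rw [h, mul_zero] at hAF; exact lt_irrefl 0 hAF
  have hF : A - B * x ^ (e₁ + 1) - 0 * x ^ (e₁ + e₂ + 2) ≠ 0 := by simpa using hF'
  rw [pair01_rowPsi2_add_eq e₁ e₂ A B hF]
  set u := rowU e₁ e₂ A B 0 x with hudef
  have hu : u = (A - B * x ^ (e₁ + 1))⁻¹ := by rw [hudef]; unfold rowU; simp
  set P := A * u with hP
  set G := (B * x ^ (e₁ + 1)) * u with hG
  have hPG : P - G = 1 := by
    rw [hP, hG, hu]; field_simp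
  have hPneg : P < 0 := by
    rw [hP, hu]
    have h2 : 0 < (A - B * x ^ (e₁ + 1)) ^ 2 := by positivity
    have : A * (A - B * x ^ (e₁ + 1))⁻¹ = A * (A - B * x ^ (e₁ + 1)) / (A - B * x ^ (e₁ + 1)) ^ 2 := by field_simp
    rw [this]; exact div_neg_of_neg_of_pos hAF h2
  have hGneg : G < 0 := by linarith
  have hPG' : 0 < P * G := mul_pos_of_neg_of_neg hPneg hGneg
  have he' : ((e₂ : ℝ) + 1) ≤ ((e₁ : ℝ) + 1) := by linarith [show (e₂ : ℝ) ≤ (e₁ : ℝ) by exact_mod_cast he]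
  have hlin : ((e₁ : ℝ) + 1) * (P + G) + ((e₂ : ℝ) + 1) < 0 := by
    have hsum : P + G < -1 := by linarith
    have hp0 : 0 < ((e₁ : ℝ) + 1) := by positivity
    nlinarith
  have hp2 : 0 < ((e₁ : ℝ) + 1) ^ 2 := by positivity
  have : ((e₁ : ℝ) + 1) ^ 2 * P * G * (((e₁ : ℝ) + 1) * (P + G) + ((e₂ : ℝ) + 1)) < 0 := by
    have h1 : 0 < ((e₁ : ℝ) + 1) ^ 2 * P * G := by rw [mul_assoc]; exact mul_pos hp2 hPG'
    exact mul_neg_of_pos_of_neg h1 hlin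
  linarith

/-- The tilted slope form `x^{e₂+1}·ψ₁` has derivative `x^{e₂}·(ψ₂ + (e₂+1)ψ₁)`. [this file's lemma] -/
theorem hasDerivAt_pow_mul_rowPsi1 {x : ℝ} (hx : x ≠ 0) (hF : A - B * x ^ (e₁ + 1) - C * x ^ (e₁ + e₂ + 2) ≠ 0) :
    HasDerivAt (fun t => t ^ (e₂ + 1) * rowPsi1 e₁ e₂ A B C t)
      (x ^ e₂ * (rowPsi2 e₁ e₂ A B C x + ((e₂ : ℝ) + 1) * rowPsi1 e₁ e₂ A B C x)) x := by
  have h1 := hasDerivAt_pow (e₂ + 1) x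
  have h2 := hasDerivAt_rowPsi1 e₁ e₂ A B C hx hF
  refine (h1.mul h2).congr_deriv ?_
  rw [show e₂ + 1 - 1 = e₂ from rfl, pow_succ]
  push_cast
  field_simp
  ring

end Row
/-! ### §2 The cell in LINE currency -/

/-- ★★ **KNEES OF RATE `q − p` BEHIND THINNER-OR-EQUAL POLES: at most ONE zero of `W(∏ f_j)` in the window.** Support `d 1 = d 0 + e₁ + 1`,
`d 2 = d 1 + e₂ + 1`, window `(u,v)`, `0 < u`.  Every row is one of: a one-signed binomial on (1,2) (`a₀ = 0 < a₁a₂`); a one-change binomial on (1,2)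
switched at `u` (`a₀ = 0`, `a₁a₂ < 0`, `0 < a₂·f(u)`); a one-change binomial on (0,2) switched at `u` (`a₁ = 0`, `a₀a₂ < 0`, `0 < a₂·f(u)`); when `e₂ ≤ e₁`,
a one-change binomial on (0,1) switched at `u` (`a₂ = 0`, `a₀a₁ < 0`, `0 < a₁·f(u)`). [this file's theorem] -/
theorem outerKnees_wronskian_roots_le_one {m : ℕ} (d : Fin 3 → ℕ) (e₁ e₂ : ℕ)
    (he₁ : d 1 = d 0 + e₁ + 1) (he₂ : d 2 = d 1 + e₂ + 1) (a : Fin m → Fin 3 → ℝ) {u v : ℝ} (hu : 0 < u)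
    (hcls : ∀ j,
      (a j 0 = 0 ∧ 0 < a j 1 * a j 2) ∨
      (a j 0 = 0 ∧ a j 1 * a j 2 < 0 ∧ 0 < a j 2 * (∑ l, C (a j l) * X ^ (d l) : ℝ[X]).eval u) ∨
      (a j 1 = 0 ∧ a j 0 * a j 2 < 0 ∧ 0 < a j 2 * (∑ l, C (a j l) * X ^ (d l) : ℝ[X]).eval u) ∨
      (e₂ ≤ e₁ ∧ a j 2 = 0 ∧ a j 0 * a j 1 < 0 ∧ 0 < a j 1 * (∑ l, C (a j l) * X ^ (d l) : ℝ[X]).eval u)) :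
    (((∏ j, ∑ l, C (a j l) * X ^ (d l) : ℝ[X]) * (X * derivative (X * derivative (∏ j, ∑ l, C (a j l) * X ^ (d l) : ℝ[X])))
        - (X * derivative (∏ j, ∑ l, C (a j l) * X ^ (d l) : ℝ[X])) ^ 2).roots.toFinset.filter (fun w => u < w ∧ w < v)).card ≤ 1 := by
  classical
  set W : ℝ[X] := (∏ j, ∑ l, C (a j l) * X ^ (d l) : ℝ[X]) * (X * derivative (X * derivative (∏ j, ∑ l, C (a j l) * X ^ (d l) : ℝ[X])))
      - (X * derivative (∏ j, ∑ l, C (a j l) * X ^ (d l) : ℝ[X])) ^ 2 with hWdef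
  by_contra hgt
  push Not at hgt
  obtain ⟨y₁, hy₁, y₂, hy₂, h12'⟩ := exists_two_lt_of_card (T := W.roots.toFinset.filter (fun w => u < w ∧ w < v)) hgt
  by_cases hW0 : W = 0
  · rw [hW0, roots_zero, Multiset.toFinset_zero, Finset.filter_empty] at hy₁; exact absurd hy₁ (Finset.notMem_empty _)
  rw [mem_filter, Multiset.mem_toFinset, mem_roots hW0] at hy₁ hy₂
  have hd := fin3_support_eq_gaps d e₁ e₂ he₁ he₂
  have hev : ∀ j x, (∑ l, C (a j l) * X ^ (d l) : ℝ[X]).eval x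
        = x ^ (d 0) * (a j 0 - (-(a j 1)) * x ^ (e₁ + 1) - (-(a j 2)) * x ^ (e₁ + e₂ + 2)) := by
    intro j x
    have h := (eval_trinomial_three (d 0) (e₁ + 1) (e₁ + e₂ + 2) (a j) x).1
    rw [hd] at h; rw [h]; ring
  have hv : u < v := hy₁.2.1.trans hy₁.2.2
  have hx0 : ∀ x ∈ Set.Icc u v, 0 < x := fun x hx => hu.trans_le hx.1
  -- per-row facts on the window: the normal form does not vanish and the tilt derivative is negative
  have hrow : ∀ x ∈ Set.Icc u v, ∀ j, a j 0 - (-(a j 1)) * x ^ (e₁ + 1) - (-(a j 2)) * x ^ (e₁ + e₂ + 2) ≠ 0 ∧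
      rowPsi2 e₁ e₂ (a j 0) (-(a j 1)) (-(a j 2)) x + ((e₂ : ℝ) + 1) * rowPsi1 e₁ e₂ (a j 0) (-(a j 1)) (-(a j 2)) x < 0 := by
    intro x hx j
    have hx' := hx0 x hx
    have hux : u ^ (e₂ + 1) ≤ x ^ (e₂ + 1) := pow_le_pow_left₀ hu.le hx.1 _
    have huq : u ^ (e₁ + e₂ + 2) ≤ x ^ (e₁ + e₂ + 2) := pow_le_pow_left₀ hu.le hx.1 _
    have hup : u ^ (e₁ + 1) ≤ x ^ (e₁ + 1) := pow_le_pow_left₀ hu.le hx.1 _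
    rcases hcls j with ⟨h0z, h12⟩ | ⟨h0z, h12, hsu⟩ | ⟨h1z, h02, hsu⟩ | ⟨he, h2z, h01, hsu⟩
    · -- knee on (1,2)
      have hγE : 0 < (-(a j 2) * x ^ (e₁ + e₂ + 2)) * (-(a j 1) * x ^ (e₁ + 1) + -(a j 2) * x ^ (e₁ + e₂ + 2)) := by
        have : (-(a j 2) * x ^ (e₁ + e₂ + 2)) * (-(a j 1) * x ^ (e₁ + 1) + -(a j 2) * x ^ (e₁ + e₂ + 2))
            = x ^ (e₁ + e₂ + 2) * x ^ (e₁ + 1) * (a j 1 * a j 2) + (x ^ (e₁ + e₂ + 2)) ^ 2 * (a j 2) ^ 2 := by ring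
        rw [this]
        have h2 : a j 2 ≠ 0 := by intro h; rw [h, mul_zero] at h12; exact lt_irrefl 0 h12
        positivity
      have h1 : a j 1 ≠ 0 := by intro h; rw [h, zero_mul] at h12; exact lt_irrefl 0 h12
      have hneg := pair12_rowPsi2_add_neg e₁ e₂ (-(a j 1)) (-(a j 2)) hx' (neg_ne_zero.2 h1) hγE
      refine ⟨?_, by rw [h0z]; exact hneg⟩
      rw [h0z]
      intro h
      have : -(a j 1) * x ^ (e₁ + 1) + -(a j 2) * x ^ (e₁ + e₂ + 2) = 0 := by linarith
      rw [this, mul_zero] at hγE; exact lt_irrefl 0 hγE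
    · -- pole on (1,2), switched at u: `a₂·f > 0` propagates to the right
      have hfac : ∀ y, a j 2 * (∑ l, C (a j l) * X ^ (d l) : ℝ[X]).eval y
          = y ^ (d 0) * y ^ (e₁ + 1) * (a j 1 * a j 2 + (a j 2) ^ 2 * y ^ (e₂ + 1)) := by
        intro y; rw [hev, h0z]; ring
      have hsu' : 0 < a j 1 * a j 2 + (a j 2) ^ 2 * u ^ (e₂ + 1) := by
        rw [hfac] at hsu; exact (mul_pos_iff_of_pos_left (by positivity)).1 hsu
      have hsx : 0 < a j 1 * a j 2 + (a j 2) ^ 2 * x ^ (e₂ + 1) := by nlinarith [sq_nonneg (a j 2)]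
      have hγE : 0 < (-(a j 2) * x ^ (e₁ + e₂ + 2)) * (-(a j 1) * x ^ (e₁ + 1) + -(a j 2) * x ^ (e₁ + e₂ + 2)) := by
        have : (-(a j 2) * x ^ (e₁ + e₂ + 2)) * (-(a j 1) * x ^ (e₁ + 1) + -(a j 2) * x ^ (e₁ + e₂ + 2))
            = x ^ (e₁ + e₂ + 2) * x ^ (e₁ + 1) * (a j 1 * a j 2 + (a j 2) ^ 2 * x ^ (e₂ + 1)) := by ring
        rw [this]; positivity
      have h1 : a j 1 ≠ 0 := by intro h; rw [h, zero_mul] at h12; exact lt_irrefl 0 h12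
      have hneg := pair12_rowPsi2_add_neg e₁ e₂ (-(a j 1)) (-(a j 2)) hx' (neg_ne_zero.2 h1) hγE
      refine ⟨?_, by rw [h0z]; exact hneg⟩
      rw [h0z]
      intro h
      have : -(a j 1) * x ^ (e₁ + 1) + -(a j 2) * x ^ (e₁ + e₂ + 2) = 0 := by linarith
      rw [this, mul_zero] at hγE; exact lt_irrefl 0 hγE
    · -- pole on (0,2), switched at u
      have hfac : ∀ y, a j 2 * (∑ l, C (a j l) * X ^ (d l) : ℝ[X]).eval y = y ^ (d 0) * (a j 0 * a j 2 + (a j 2) ^ 2 * y ^ (e₁ + e₂ + 2)) := by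
        intro y; rw [hev, h1z]; ring
      have hsu' : 0 < a j 0 * a j 2 + (a j 2) ^ 2 * u ^ (e₁ + e₂ + 2) := by
        rw [hfac] at hsu; exact (mul_pos_iff_of_pos_left (by positivity)).1 hsu
      have hsx : 0 < a j 0 * a j 2 + (a j 2) ^ 2 * x ^ (e₁ + e₂ + 2) := by nlinarith [sq_nonneg (a j 2)]
      -- `A·F < 0` with `A = a₀`, `F = a₀ + a₂x^q`: multiply `hsx` by `a₀/a₂ < 0`
      have hAF : a j 0 * (a j 0 - (-(a j 2)) * x ^ (e₁ + e₂ + 2)) < 0 := by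
        have : a j 0 * (a j 0 - (-(a j 2)) * x ^ (e₁ + e₂ + 2)) * (a j 2) ^ 2
            = (a j 0 * a j 2) * (a j 0 * a j 2 + (a j 2) ^ 2 * x ^ (e₁ + e₂ + 2)) := by ring
        have hneg : a j 0 * (a j 0 - (-(a j 2)) * x ^ (e₁ + e₂ + 2)) * (a j 2) ^ 2 < 0 := by
          rw [this]; exact mul_neg_of_neg_of_pos h02 hsx
        have h2 : 0 < (a j 2) ^ 2 := by
          have : a j 2 ≠ 0 := by intro h; rw [h, mul_zero] at h02; exact lt_irrefl 0 h02
          positivity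
        by_contra hge; push Not at hge
        have := mul_nonneg hge h2.le; linarith
      have hneg := pair02_rowPsi2_add_neg e₁ e₂ (a j 0) (-(a j 2)) hAF
      refine ⟨?_, by rw [h1z, neg_zero]; exact hneg⟩
      rw [h1z, neg_zero]
      intro h
      have h' : a j 0 - (-(a j 2)) * x ^ (e₁ + e₂ + 2) = 0 := by simpa using h
      rw [h', mul_zero] at hAF; exact lt_irrefl 0 hAF
    · -- pole on (0,1), switched at u, `e₂ ≤ e₁`
      have hfac : ∀ y, a j 1 * (∑ l, C (a j l) * X ^ (d l) : ℝ[X]).eval y = y ^ (d 0) * (a j 0 * a j 1 + (a j 1) ^ 2 * y ^ (e₁ + 1)) := by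
        intro y; rw [hev, h2z]; ring
      have hsu' : 0 < a j 0 * a j 1 + (a j 1) ^ 2 * u ^ (e₁ + 1) := by
        rw [hfac] at hsu; exact (mul_pos_iff_of_pos_left (by positivity)).1 hsu
      have hsx : 0 < a j 0 * a j 1 + (a j 1) ^ 2 * x ^ (e₁ + 1) := by nlinarith [sq_nonneg (a j 1)]
      have hAF : a j 0 * (a j 0 - (-(a j 1)) * x ^ (e₁ + 1)) < 0 := by
        have : a j 0 * (a j 0 - (-(a j 1)) * x ^ (e₁ + 1)) * (a j 1) ^ 2
            = (a j 0 * a j 1) * (a j 0 * a j 1 + (a j 1) ^ 2 * x ^ (e₁ + 1)) := by ring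
        have hneg : a j 0 * (a j 0 - (-(a j 1)) * x ^ (e₁ + 1)) * (a j 1) ^ 2 < 0 := by
          rw [this]; exact mul_neg_of_neg_of_pos h01 hsx
        have h2 : 0 < (a j 1) ^ 2 := by
          have : a j 1 ≠ 0 := by intro h; rw [h, mul_zero] at h01; exact lt_irrefl 0 h01
          positivity
        by_contra hge; push Not at hge
        have := mul_nonneg hge h2.le; linarith
      have hneg := pair01_rowPsi2_add_neg e₁ e₂ (a j 0) (-(a j 1)) he hAF
      refine ⟨?_, by rw [h2z, neg_zero]; exact hneg⟩
      rw [h2z, neg_zero]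
      intro h
      have h' : a j 0 - (-(a j 1)) * x ^ (e₁ + 1) = 0 := by simpa using h
      rw [h', mul_zero] at hAF; exact lt_irrefl 0 hAF
  have hf : ∀ x ∈ Set.Icc u v, ∀ j, (∑ l, C (a j l) * X ^ (d l) : ℝ[X]).eval x ≠ 0 := by
    intro x hx j
    rw [hev]; exact mul_ne_zero (pow_ne_zero _ (hx0 x hx).ne') (hrow x hx j).1
  -- the tilted sum `G = x^{e₂+1}·Σ_j ψ₁_j` is strictly decreasing
  set G : ℝ → ℝ := fun t => t ^ (e₂ + 1) * ∑ j, rowPsi1 e₁ e₂ (a j 0) (-(a j 1)) (-(a j 2)) t with hG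
  have hGder : ∀ x ∈ Set.Icc u v, HasDerivAt G
      (x ^ e₂ * ∑ j, (rowPsi2 e₁ e₂ (a j 0) (-(a j 1)) (-(a j 2)) x + ((e₂ : ℝ) + 1) * rowPsi1 e₁ e₂ (a j 0) (-(a j 1)) (-(a j 2)) x)) x := by
    intro x hx
    have h := HasDerivAt.fun_sum (u := Finset.univ) fun j _ =>
      hasDerivAt_pow_mul_rowPsi1 e₁ e₂ (a j 0) (-(a j 1)) (-(a j 2)) (hx0 x hx).ne' (hrow x hx j).1
    refine (h.congr_of_eventuallyEq (Filter.Eventually.of_forall fun t => ?_)).congr_deriv ?_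
    · simp only [hG, Finset.mul_sum]
    · rw [Finset.mul_sum]
  rcases isEmpty_or_nonempty (Fin m) with hm | hm
  · apply hW0
    rw [hWdef]
    simp [Finset.univ_eq_empty]
  obtain ⟨j₀⟩ := hm
  have hcont : ContinuousOn G (Set.Icc u v) := fun x hx => (hGder x hx).continuousAt.continuousWithinAt
  have hanti : StrictAntiOn G (Set.Icc u v) := by
    refine strictAntiOn_of_deriv_neg (convex_Icc u v) hcont fun x hx => ?_
    rw [interior_Icc] at hx
    have hxI : x ∈ Set.Icc u v := ⟨hx.1.le, hx.2.le⟩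
    rw [(hGder x hxI).deriv]
    have hs : ∑ j, (rowPsi2 e₁ e₂ (a j 0) (-(a j 1)) (-(a j 2)) x + ((e₂ : ℝ) + 1) * rowPsi1 e₁ e₂ (a j 0) (-(a j 1)) (-(a j 2)) x) < 0 := by
      calc ∑ j, (rowPsi2 e₁ e₂ (a j 0) (-(a j 1)) (-(a j 2)) x + ((e₂ : ℝ) + 1) * rowPsi1 e₁ e₂ (a j 0) (-(a j 1)) (-(a j 2)) x)
          < ∑ _j : Fin m, (0 : ℝ) := Finset.sum_lt_sum_of_nonempty ⟨j₀, Finset.mem_univ _⟩ (fun j _ => (hrow x hxI j).2)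
        _ = 0 := by simp
    exact mul_neg_of_pos_of_neg (pow_pos (hx0 x hxI) _) hs
  have hGz : ∀ y, W.eval y = 0 → y ∈ Set.Icc u v → G y = 0 := by
    intro y hy hyI
    have h := hy
    rw [hWdef, logWronskian_prod_eq_rowPsi1_sum d e₁ e₂ he₁ he₂ a (hx0 y hyI) (hf y hyI)] at h
    have hP : ((∏ j, (∑ l, C (a j l) * X ^ (d l) : ℝ[X])).eval y) ≠ 0 := by
      rw [eval_prod]; exact Finset.prod_ne_zero_iff.2 fun j _ => hf y hyI j
    rcases mul_eq_zero.1 h with h1 | h1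
    · exact absurd (neg_eq_zero.1 h1) (pow_ne_zero 2 hP)
    · simp only [hG, h1, mul_zero]
  have hI1 : y₁ ∈ Set.Icc u v := ⟨hy₁.2.1.le, hy₁.2.2.le⟩
  have hI2 : y₂ ∈ Set.Icc u v := ⟨hy₂.2.1.le, hy₂.2.2.le⟩
  have hlt := hanti hI1 hI2 h12'
  rw [hGz y₁ hy₁.1 hI1, hGz y₂ hy₂.1 hI2] at hlt
  exact lt_irrefl _ hlt

/-- ★ **Euler currency:** under the same hypotheses, `eulerNumerator d a l₀` has at most TWO roots on `[u,v]`, for every coupling `l₀`. [this file's theorem] -/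
theorem outerKnees_eulerNumerator_roots_le_two {m : ℕ} (d : Fin 3 → ℕ) (e₁ e₂ : ℕ)
    (he₁ : d 1 = d 0 + e₁ + 1) (he₂ : d 2 = d 1 + e₂ + 1) (a : Fin m → Fin 3 → ℝ) (l₀ : Fin 3) {u v : ℝ} (hu : 0 < u)
    (hcls : ∀ j,
      (a j 0 = 0 ∧ 0 < a j 1 * a j 2) ∨
      (a j 0 = 0 ∧ a j 1 * a j 2 < 0 ∧ 0 < a j 2 * (∑ l, C (a j l) * X ^ (d l) : ℝ[X]).eval u) ∨
      (a j 1 = 0 ∧ a j 0 * a j 2 < 0 ∧ 0 < a j 2 * (∑ l, C (a j l) * X ^ (d l) : ℝ[X]).eval u) ∨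
      (e₂ ≤ e₁ ∧ a j 2 = 0 ∧ a j 0 * a j 1 < 0 ∧ 0 < a j 1 * (∑ l, C (a j l) * X ^ (d l) : ℝ[X]).eval u)) :
    ((∑ j, (∑ l, C (a j l * ((d l : ℝ) - d l₀)) * X ^ (d l)) * ∏ i ∈ Finset.univ.erase j, (∑ l, C (a i l) * X ^ (d l))
        : ℝ[X]).roots.toFinset.filter (fun t => u ≤ t ∧ t ≤ v)).card ≤ 2 := by
  classical
  have hd := fin3_support_eq_gaps d e₁ e₂ he₁ he₂
  have hev : ∀ j x, (∑ l, C (a j l) * X ^ (d l) : ℝ[X]).eval x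
        = x ^ (d 0) * (a j 0 - (-(a j 1)) * x ^ (e₁ + 1) - (-(a j 2)) * x ^ (e₁ + e₂ + 2)) := by
    intro j x
    have h := (eval_trinomial_three (d 0) (e₁ + 1) (e₁ + e₂ + 2) (a j) x).1
    rw [hd] at h; rw [h]; ring
  have hP : ∀ t ∈ Set.Icc u v, (∏ j, (∑ l, C (a j l) * X ^ (d l) : ℝ[X])).eval t ≠ 0 := by
    intro t ht
    have ht0 : 0 < t := hu.trans_le ht.1
    rw [eval_prod]
    refine Finset.prod_ne_zero_iff.2 fun j _ => ?_
    have key : ∀ (c : ℝ) (k n : ℕ) (α : ℝ), 0 < α + c ^ 2 * u ^ n →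
        (∀ y, c * (∑ l, C (a j l) * X ^ (d l) : ℝ[X]).eval y = y ^ (d 0) * y ^ k * (α + c ^ 2 * y ^ n)) →
        (∑ l, C (a j l) * X ^ (d l) : ℝ[X]).eval t ≠ 0 := by
      intro c k n α hαu hfac h
      have htn : u ^ n ≤ t ^ n := pow_le_pow_left₀ hu.le ht.1 _
      have hαt : 0 < α + c ^ 2 * t ^ n := by nlinarith [sq_nonneg c]
      have := hfac t
      rw [h, mul_zero] at this
      have : (0 : ℝ) < 0 := by
        calc (0 : ℝ) = t ^ d 0 * t ^ k * (α + c ^ 2 * t ^ n) := this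
          _ > 0 := by positivity
      exact lt_irrefl 0 this
    rcases hcls j with ⟨h0z, h12⟩ | ⟨h0z, h12, hsu⟩ | ⟨h1z, h02, hsu⟩ | ⟨_, h2z, h01, hsu⟩
    · rw [hev, h0z]
      refine mul_ne_zero (pow_ne_zero _ ht0.ne') ?_
      have : (0 : ℝ) - (-(a j 1)) * t ^ (e₁ + 1) - (-(a j 2)) * t ^ (e₁ + e₂ + 2) = t ^ (e₁ + 1) * (a j 1 + a j 2 * t ^ (e₂ + 1)) := by ring
      rw [this]
      refine mul_ne_zero (pow_ne_zero _ ht0.ne') ?_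
      intro h
      have ha1 : a j 1 = -(a j 2 * t ^ (e₂ + 1)) := by linarith
      rw [ha1] at h12
      nlinarith [mul_nonneg (sq_nonneg (a j 2)) (pow_pos ht0 (e₂ + 1)).le]
    · refine key (a j 2) (e₁ + 1) (e₂ + 1) (a j 1 * a j 2) ?_ (fun y => by rw [hev, h0z]; ring)
      have := hsu; rw [hev, h0z] at this
      have hfac' : a j 2 * (u ^ d 0 * (0 - (-(a j 1)) * u ^ (e₁ + 1) - (-(a j 2)) * u ^ (e₁ + e₂ + 2)))
          = u ^ (d 0) * u ^ (e₁ + 1) * (a j 1 * a j 2 + (a j 2) ^ 2 * u ^ (e₂ + 1)) := by ring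
      rw [hfac'] at this
      exact (mul_pos_iff_of_pos_left (by positivity)).1 this
    · refine key (a j 2) 0 (e₁ + e₂ + 2) (a j 0 * a j 2) ?_ (fun y => by rw [hev, h1z]; ring)
      have := hsu; rw [hev, h1z] at this
      have hfac' : a j 2 * (u ^ d 0 * (a j 0 - (-0) * u ^ (e₁ + 1) - (-(a j 2)) * u ^ (e₁ + e₂ + 2)))
          = u ^ (d 0) * u ^ 0 * (a j 0 * a j 2 + (a j 2) ^ 2 * u ^ (e₁ + e₂ + 2)) := by ring
      rw [hfac'] at this
      exact (mul_pos_iff_of_pos_left (by positivity)).1 this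
    · refine key (a j 1) 0 (e₁ + 1) (a j 0 * a j 1) ?_ (fun y => by rw [hev, h2z]; ring)
      have := hsu; rw [hev, h2z] at this
      have hfac' : a j 1 * (u ^ d 0 * (a j 0 - (-(a j 1)) * u ^ (e₁ + 1) - (-0) * u ^ (e₁ + e₂ + 2)))
          = u ^ (d 0) * u ^ 0 * (a j 0 * a j 1 + (a j 1) ^ 2 * u ^ (e₁ + 1)) := by ring
      rw [hfac'] at this
      exact (mul_pos_iff_of_pos_left (by positivity)).1 this
  have h1 := eulerNumerator_roots_Icc_le_wronskian_roots_add_one d a l₀ hu hP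
  have h2 := outerKnees_wronskian_roots_le_one (v := v) d e₁ e₂ he₁ he₂ a hu hcls
  omega

end ProductPlusOne

end Summit.ValiantsHypothesis.ValiantsHypothesis.Theorems.LacunarySymmetroidMatrixDescartes
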